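import Summits.KontsevichZagierPeriods.KontsevichZagierPeriods.Theorems.RootDecompRationalCubeDichotomyRankDescentP16

/-! # `RootDecompRationalCubeDichotomyRankDescentP17` — part 3/9 of the mechanical ≤400-line split of `RankDescent_delta_v12_to_v14h_P15plus.lean` (sha256 311877f354eea7b0…)
Source: decomp-kz lens-2 g15 RankDescent_delta_v12_to_v14h_P15plus.lean @311877f3 (critic CLEARED g7-6 l.1400: 26322 ⟺ LetterDegenerateKernel, GenericKernel THEOREM); --supports stmt-KontsevichZagierPeriods-26322.
Split by census-1 g10 `gen/splitlean.py`: scopes re-opened with their `open`/`variable`/`set_option` context; mathematics and declaration order unchanged. -/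

noncomputable section
open MeasureTheory Set MvPolynomial
open Literature.NumberTheory.Transcendental
open Literature.NumberTheory.Transcendental.KZ
namespace Summit.KontsevichZagierPeriods.RootDecompRationalCubeDichotomy.Rung26322.RankDescent
variable {M : ℕ}
open MeasureTheory Set MvPolynomial in
open Literature.NumberTheory.Transcendental in
open Literature.NumberTheory.Transcendental.KZ in
open MeasureTheory Set MvPolynomial in
open Literature.NumberTheory.Transcendental in
open Literature.NumberTheory.Transcendental.KZ in
/-- `∂_k`-antiderivatives exist in `ℚ[x]`. [folklore] -/
private theorem exists_pderiv_eq (k : Fin M) (P : MvPolynomial (Fin M) ℚ) :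
    ∃ G : MvPolynomial (Fin M) ℚ, pderiv k G = P := by
  have hv : (Pi.single k (1:ℚ) : Fin M → ℚ) ≠ 0 := by
    intro h
    have := congrFun h k
    simp at this
  obtain ⟨G, hG⟩ := exists_dirD_eq (Pi.single k (1:ℚ)) hv P
  refine ⟨G, ?_⟩
  have hs : (∑ j, (Pi.single k (1:ℚ) : Fin M → ℚ) j • (pderiv j G : MvPolynomial (Fin M) ℚ)) = pderiv k G := by
    rw [Finset.sum_eq_single k (fun j _ hj => by simp [hj])
      (fun h => (h (Finset.mem_univ k)).elim)]
    simp
  rw [dirD_apply, hs] at hG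
  exact hG

open MeasureTheory Set MvPolynomial in
open Literature.NumberTheory.Transcendental in
open Literature.NumberTheory.Transcendental.KZ in
open MeasureTheory Set MvPolynomial in
open Literature.NumberTheory.Transcendental in
open Literature.NumberTheory.Transcendental.KZ in
/-- Soundness: congruent formal combinations have equal values. (cite KontsevichZagier2001, §1.2) -/
private theorem eval_eq_of_sub_mem {x y : FormalRep} (h : x - y ∈ relations) : eval x = eval y := by
  have h' := relations_le_ker_eval_holds h
  rw [AddMonoidHom.mem_ker, map_sub] at h'
  exact sub_eq_zero.1 h'

section Diophantine
variable {n : ℕ}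
variable (q₀ : ℚ) (hq : 0 < q₀ ∨ q₀ < -1)

include hq in
/-- Auxiliary step `q₀_ne_zero` (§17): q₀ ne zero. [bookkeeping] -/
private theorem q₀_ne_zero : (q₀ : ℝ) ≠ 0 := by
  have : q₀ ≠ 0 := by
    rcases hq with h | h
    · exact h.ne'
    · exact (lt_trans h (by norm_num : (-1 : ℚ) < 0)).ne
  exact_mod_cast this

/-- **The dimension-2 census class `Q = q₀ + xy`, read against the literature.** §9's residual
`FermatHyperbolicResidual 1 q₀` follows from `L_2(q₀) ∉ ℚ + ℚ·log((q₀+1)/q₀)`; with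
`L_2(q₀) = −Li_2(−1/q₀)` (`LettersArePolylogs`) this is a THEOREM for integers `q₀ ≥ 5 ∨ q₀ ≤ −6`
[Rhin–Viola 2019, §5 (`1, Li_1(1/s), Li_2(1/s)` ℚ-linearly independent for `s ≤ −5 ∨ s ≥ 6`);
Hata 1993, Table 2]. [folklore] -/
theorem fermatHyperbolicResidual_one_of_dilog_new
    (h : ∀ c₀ c₁ : ℚ, letter q₀ hq 2 ≠ c₀ + c₁ * Real.log ((q₀ + 1) / q₀)) :
    FermatHyperbolicResidual 1 q₀ := by
  refine fermatHyperbolicResidual_of_topLetterNew q₀ hq ?_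
  rintro ⟨c₀, c, hc⟩
  apply h c₀ (c 0)
  rw [hc, Fin.sum_univ_one]
  show (c₀ : ℝ) + (c 0 : ℝ) * letter q₀ hq (0 + 1) = _
  rw [zero_add, letter_one]

/-- THE IDENTIFICATION (PROVED below: `lettersArePolylogs`, `letter_eq_neg_polylog`; `j = 1`: `letter_one`):
the letters ARE the polylogarithm values, `L_j(q₀) = Σ_{k≥0} (−1)^k q₀^{−(k+1)} (k+1)^{−j} = −Li_j(−1/q₀)` for `|q₀| > 1`, `j ≥ 1`
(expand `1/(q₀ + u) = Σ_k (−1)^k u^k q₀^{−k−1}`, uniformly convergent on `|u| ≤ 1 < |q₀|`, and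
`∫_{[0,1]^j} (x₁⋯x_j)^k dx = (k+1)^{−j}`); at `q₀ = 1` the series converges conditionally to `η(j) = L_j(1)`
(`π²/12`, `(3/4)ζ(3)`, …) and for `0 < q₀ < 1` the letter is the analytically continued `−Li_j(−1/q₀)`, no
longer a power series in `1/q₀`. It is what matches `LettersLinIndep` with the cited theorems (all of which
have `|q₀| ≥ 2`). (folklore) -/
def LettersArePolylogs : Prop :=
  1 < |q₀| → ∀ j : ℕ, 1 ≤ j →
    HasSum (fun k : ℕ => (-1 : ℝ) ^ k / ((q₀ : ℝ) ^ (k + 1) * ((k : ℝ) + 1) ^ j)) (letter q₀ hq j)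

/-! ### The letters as series: `L_j(q₀) = −Li_j(−1/q₀)` for `|q₀| > 1` -/

/-- `∫_{[0,1]^j} (x₁⋯x_j)^k dx = (k+1)^{−j}`. [folklore] -/
theorem integral_cube_prod_pow (j k : ℕ) :
    ∫ x in KZ.cube j, (∏ i, x i) ^ k = (((k : ℝ) + 1) ^ j)⁻¹ := by
  rw [KZ.cube_eq_pi, volume_pi, Measure.restrict_pi_pi]
  simp_rw [← Finset.prod_pow]
  rw [integral_fintype_prod_eq_prod (𝕜 := ℝ) (fun (_ : Fin j) (y : ℝ) => y ^ k),
    Finset.prod_const, Finset.card_univ, Fintype.card_fin, integral_Icc_eq_integral_Ioc,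
    ← intervalIntegral.integral_of_le zero_le_one, integral_pow, one_pow,
    zero_pow (Nat.succ_ne_zero k), sub_zero, one_div, inv_pow]

/-- **The letters ARE the polylogarithm values** for `|q₀| > 1` (PROVED):
`L_j(q₀) = Σ_{k≥0} (−1)^k q₀^{−(k+1)} (k+1)^{−j}` (`= −Li_j(−1/q₀)`), every `j` — geometric expansion of
`1/(q₀ + u)` on `0 ≤ u = x₁⋯x_j ≤ 1 < |q₀|`, dominated convergence, and `integral_cube_prod_pow`. [folklore] -/
theorem letter_hasSum (hq' : 1 < |q₀|) (j : ℕ) :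
    HasSum (fun k : ℕ => (-1 : ℝ) ^ k / ((q₀ : ℝ) ^ (k + 1) * ((k : ℝ) + 1) ^ j)) (letter q₀ hq j) := by
  have hq0 : (q₀ : ℝ) ≠ 0 := q₀_ne_zero q₀ hq
  have hq1 : 1 < |(q₀ : ℝ)| := by rw [← Rat.cast_abs]; exact_mod_cast hq'
  set ρ : ℝ := |(q₀ : ℝ)|⁻¹ with hρ
  have hρ0 : 0 ≤ ρ := inv_nonneg.2 (abs_nonneg _)
  have hρ1 : ρ < 1 := inv_lt_one_of_one_lt₀ hq1
  have hfn : ∀ x : Fin j → ℝ, (fhR q₀ hq j 1).fn x = ((q₀ : ℝ) + ∏ i, x i)⁻¹ := by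
    intro x
    rw [fhR_fn, aeval_fhQ, map_one, one_div]
  have key := hasSum_integral_of_dominated_convergence (μ := volume.restrict (KZ.cube j))
    (F := fun (k : ℕ) (x : Fin j → ℝ) => (-1 : ℝ) ^ k * (∏ i, x i) ^ k / (q₀ : ℝ) ^ (k + 1))
    (f := fun x => ((q₀ : ℝ) + ∏ i, x i)⁻¹) (fun k _ => ρ * ρ ^ k) ?_ ?_ ?_ ?_ ?_
  · have hterm : ∀ k : ℕ, ∫ x in KZ.cube j, (-1 : ℝ) ^ k * (∏ i, x i) ^ k / (q₀ : ℝ) ^ (k + 1)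
        = (-1 : ℝ) ^ k / ((q₀ : ℝ) ^ (k + 1) * ((k : ℝ) + 1) ^ j) := by
      intro k
      rw [integral_div, integral_const_mul, integral_cube_prod_pow]
      ring
    unfold letter fhV
    rw [value_rep_eq, setIntegral_congr_fun KZ.measurableSet_cube (fun x _ => hfn x)]
    simpa only [hterm] using key
  · intro k
    exact ((continuous_const.mul ((continuous_finsetProd _ fun i _ => continuous_apply i).pow k)).div_const
      _).aestronglyMeasurable
  · intro k
    refine ae_restrict_of_forall_mem KZ.measurableSet_cube fun x hx => ?_
    obtain ⟨h0, h1⟩ := prod_mem_Icc_of_mem_cube hx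
    show ‖(-1 : ℝ) ^ k * (∏ i, x i) ^ k / (q₀ : ℝ) ^ (k + 1)‖ ≤ ρ * ρ ^ k
    have hF : ‖(-1 : ℝ) ^ k * (∏ i, x i) ^ k / (q₀ : ℝ) ^ (k + 1)‖ = (∏ i, x i) ^ k / |(q₀ : ℝ)| ^ (k + 1) := by
      simp only [Real.norm_eq_abs, abs_div, abs_mul, abs_pow, abs_neg, abs_one, one_pow, one_mul,
        abs_of_nonneg h0]
    have hρk : ρ * ρ ^ k = 1 / |(q₀ : ℝ)| ^ (k + 1) := by rw [← pow_succ', hρ, inv_pow, one_div]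
    rw [hF, hρk]
    exact div_le_div_of_nonneg_right (pow_le_one₀ h0 h1) (pow_nonneg (abs_nonneg _) _)
  · exact ae_of_all _ fun _ => (summable_geometric_of_lt_one hρ0 hρ1).mul_left ρ
  · exact integrableOn_const (by rw [KZ.volume_cube]; exact ENNReal.one_ne_top)
  · refine ae_restrict_of_forall_mem KZ.measurableSet_cube fun x hx => ?_
    obtain ⟨h0, h1⟩ := prod_mem_Icc_of_mem_cube hx
    show HasSum (fun k : ℕ => (-1 : ℝ) ^ k * (∏ i, x i) ^ k / (q₀ : ℝ) ^ (k + 1)) (((q₀ : ℝ) + ∏ i, x i)⁻¹)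
    have hr : |(-((∏ i, x i) / (q₀ : ℝ)))| < 1 := by
      rw [abs_neg, abs_div, abs_of_nonneg h0]
      calc (∏ i, x i) / |(q₀ : ℝ)| ≤ 1 / |(q₀ : ℝ)| := div_le_div_of_nonneg_right h1 (abs_nonneg _)
        _ < 1 := by rw [one_div]; exact hρ1
    have hgeo := (hasSum_geometric_of_abs_lt_one hr).mul_left ((q₀ : ℝ)⁻¹)
    have hfun : (fun k : ℕ => (-1 : ℝ) ^ k * (∏ i, x i) ^ k / (q₀ : ℝ) ^ (k + 1))
        = fun k => (q₀ : ℝ)⁻¹ * (-((∏ i, x i) / (q₀ : ℝ))) ^ k := by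
      funext k
      conv_rhs => rw [neg_pow, div_pow]
      rw [pow_succ, div_eq_mul_inv, div_eq_mul_inv, mul_inv]
      ring
    have hval : (q₀ : ℝ)⁻¹ * (1 - -((∏ i, x i) / (q₀ : ℝ)))⁻¹ = ((q₀ : ℝ) + ∏ i, x i)⁻¹ := by
      rw [sub_neg_eq_add, ← mul_inv, mul_add, mul_one, mul_div_cancel₀ _ hq0]
    rw [hfun, ← hval]
    exact hgeo

/-- `LettersArePolylogs` holds. -/
theorem lettersArePolylogs : LettersArePolylogs q₀ hq := fun hq' j _ => letter_hasSum q₀ hq hq' j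

/-- The polylogarithm inside the unit disc, as its power series
`Li_j(x) = Σ_{m≥1} x^m/m^j = Σ_{k≥0} x^{k+1}/(k+1)^j`. (folklore) -/
def polylogSeries (j : ℕ) (x : ℝ) : ℝ := ∑' k : ℕ, x ^ (k + 1) / ((k : ℝ) + 1) ^ j

/-- **`L_j(q₀) = −Li_j(−1/q₀)`** for `|q₀| > 1`, every `j`. [folklore] -/
theorem letter_eq_neg_polylog (hq' : 1 < |q₀|) (j : ℕ) :
    letter q₀ hq j = -polylogSeries j (-1 / (q₀ : ℝ)) := by
  have h := letter_hasSum q₀ hq hq' j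
  have hf : (fun k : ℕ => (-1 / (q₀ : ℝ)) ^ (k + 1) / ((k : ℝ) + 1) ^ j)
      = fun k : ℕ => -((-1 : ℝ) ^ k / ((q₀ : ℝ) ^ (k + 1) * ((k : ℝ) + 1) ^ j)) := by
    funext k
    rw [div_pow, pow_succ (-1 : ℝ) k, div_div, mul_neg_one, neg_div]
  have h2 : HasSum (fun k : ℕ => (-1 / (q₀ : ℝ)) ^ (k + 1) / ((k : ℝ) + 1) ^ j) (-letter q₀ hq j) := by
    rw [hf]
    exact h.neg
  rw [polylogSeries, h2.tsum_eq, neg_neg]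

/-- **The Diophantine input in the literature's words** (`|q₀| > 1`): `LettersLinIndep q₀ n` iff
`1, Li_1(−1/q₀), …, Li_n(−1/q₀)` are linearly independent over `ℚ` — the statement proved by
Hata 1990 (Cor. 2.2) for `x = −1/q₀ = 1/b`, `b ∈ ℤ`, `log|b| > log E(n)`, and by Hata 1993 /
Rhin–Viola 2005, 2019 for `n = 2`, `b ≤ −5 ∨ b ≥ 6`. [folklore] -/
theorem lettersLinIndep_iff_polylog (hq' : 1 < |q₀|) (n : ℕ) :
    LettersLinIndep q₀ hq n ↔
      ∀ (c₀ : ℚ) (c : Fin n → ℚ),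
        (c₀ : ℝ) + ∑ j : Fin n, (c j : ℝ) * polylogSeries ((j : ℕ) + 1) (-1 / (q₀ : ℝ)) = 0 →
          c₀ = 0 ∧ c = 0 := by
  have hL : ∀ j, polylogSeries j (-1 / (q₀ : ℝ)) = -letter q₀ hq j := fun j => by
    rw [letter_eq_neg_polylog q₀ hq hq' j, neg_neg]
  constructor
  · intro h c₀ c hc
    have h' := h c₀ (-c) (by simpa only [Pi.neg_apply, Rat.cast_neg, hL, neg_mul, mul_neg, neg_neg] using hc)
    exact ⟨h'.1, neg_eq_zero.mp h'.2⟩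
  · intro h c₀ c hc
    have h' := h c₀ (-c) (by simpa only [Pi.neg_apply, Rat.cast_neg, hL, neg_mul, mul_neg, neg_neg] using hc)
    exact ⟨h'.1, neg_eq_zero.mp h'.2⟩

/-- **26322 on the tower, in the literature's words** (`|q₀| > 1`): if
`1, Li_1(−1/q₀), …, Li_n(−1/q₀)` are linearly independent over `ℚ`, then EVERY value-zero
`P/(q₀ + x₀⋯x_{n−1})`, `P ∈ ℚ[x]`, on `[0,1]^n` is `∼ 0` in the KZ calculus with exponent `N = 0`.
With Hata 1990 Cor. 2.2 (cited, not formalised) this is unconditional for `q₀ = −b`, `b ∈ ℤ`,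
`|b| ≥ 2, 12, 1038, 797102` (`n = 1, 2, 3, 4`). -/
theorem fh_decided_of_polylogIndep (hq' : 1 < |q₀|) (n : ℕ)
    (hLi : ∀ (c₀ : ℚ) (c : Fin n → ℚ),
      (c₀ : ℝ) + ∑ j : Fin n, (c j : ℝ) * polylogSeries ((j : ℕ) + 1) (-1 / (q₀ : ℝ)) = 0 →
        c₀ = 0 ∧ c = 0)
    (P : MvPolynomial (Fin n) ℚ) (hP : fhV q₀ hq n P = 0) :
    KZ.of (fhR q₀ hq n P).rep ∈ KZ.relations :=
  fh_decided q₀ hq n ((lettersLinIndep_iff_polylog q₀ hq hq' n).2 hLi) P hP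

/-- Sanity: no letters, no condition. -/
example : LettersLinIndep q₀ hq 0 := by
  intro c₀ c hc
  simp only [Finset.univ_eq_empty, Finset.sum_empty, add_zero, Rat.cast_eq_zero] at hc
  exact ⟨hc, Subsingleton.elim _ _⟩

end Diophantine

/-! ## §18 (v14, g15) THE UNIFORM LETTER CRITERION — the special/generic cut by the ARITHMETIC OF THE LETTERS, for EVERY denominator

**Node (g15).** `26322 ⟸ GenericKernel (THEOREM, N = 0) ∧ SpecialKernel (typed residual)`
(`rationalCubePiKernelSingle_of_special : SpecialKernel → RationalCubePiKernelSingle`, the generic piece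
being discharged by `genericKernel_holds`; exhaustion = excluded middle on `IsGeneric Q`). The cut
`IsGeneric Q`: the denominator `Q` lies in a DENOMINATOR SYSTEM `D` (one set of polynomials per dimension,
all zero-free on the closed cubes — `ZeroFree` —, closed under the `2k` faces `x_j := 0, 1` — `FaceClosed`)
which is LETTER-GENERIC at every level `2 … m` (`GenAt D (k+1)`, `k + 2 ≤ m`): there is a family of LETTERS
`T_i = num_i/den_i`, `den_i ∈ D (k+1)`, such that
  (SPAN)  every numerator over every `F ∈ D (k+1)` is, modulo the `s = 0`-exact numerators `Ex0m F` (§9: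
          `P·F = Σ_j (∂_j G_j·F − G_j·∂_j F)`, i.e. `P/F = Σ_j ∂_j(G_j/F)`), a finite `ℚ`-combination of
          the `num_i` with `den_i = F` — the FORMAL side, pure commutative algebra (a Griffiths–Dwork /
          de Rham reduction with simple poles), and
  (INDEP) `Σ_i c_i ∫T_i ∈ VSpan D k ⟹ c = 0`, where `VSpan D k` is the `ℚ`-span of ALL values of ALL cube
          representations of dimension `≤ k` with denominators in `D` — the NUMERIC side, a Diophantine
          statement about explicitly named constants.
**THEOREM U** (`familyKernel_of_generic`, PROVED, every dimension, `N = 0`): if `D` is zero-free,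
face-closed and generic at the levels `2 … m`, then EVERY finite family of cube representations of
dimension `k ≤ m` with denominators in `D k` and total value `0` sums to an element of `KZ.relations`
(`FamilyKernel D k`); in particular (`rep_mem_relations_of_generic`, `generic_mem_relations`,
`genericKernel_holds`) every single `[ [0,1]^m, P/Q ]` of value `0` with `Q` generic is `≡ 0` — crux 26322
with `N = 0` on the generic class, for EVERY numerator `P`.
Proof (induction on the dimension). `k ≤ 1` (`familyKernel_of_le_one`): merge the family over a common
denominator (`fmerge`, rule 1) and use Baker-in-the-tree (`rep_mem_relations_of_dim_le_one`) — NO letter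
hypothesis is asked at the levels `0, 1`. `k+1 → k+2` (`familyKernel_succ`): write each numerator as
`E_a + Σ_i c_{a,i} num_i` with `E_a ∈ Ex0m` (SPAN; formally `[t_a] ≡ [E_a] + Σ_i [c_{a,i} T_i]` by rule 1);
the exact parts descend FORMALLY to their `2(k+2)` signed faces (`exact_rel_faceFam` = §5 with `s = 0`),
whose denominators stay in `D` (face closure), so `value E_a ∈ VSpan D (k+1)`; total value `0` then puts
`Σ_i (Σ_a c_{a,i})·∫T_i` in `VSpan D (k+1)`, INDEP kills every total coefficient `Σ_a c_{a,i}`, the letter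
representations cancel FORMALLY letter by letter (rule 1: `Σ_a [c_{a,i}·num_i/den_i] ≡ [0/den_i] ≡ 0`),
and the face family — dimension `k+1`, denominators in `D`, total value `0` — is a relation by induction.
(Also proved on the way, transcendence-free: `exists_rat_value_poly` — `∫_{[0,1]^k} P ∈ ℚ` inside the
calculus, by Stokes, no Fubini.)
**INSTANCE 1 (§17 re-derived and SHARPENED).** `towerSys q₀ n` = the towers `q₀ + x₀⋯x_{k-1}` (`k ≤ n`) and the
non-zero constants; `genAt_towerSys : TopLetterNew q₀ k → GenAt (towerSys q₀ n) k` (ONE letter, SPAN = §9's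
`sub_C_diagAltm_mem`, INDEP = `L_{k+1}(q₀) ∉ ℚ + Σ_{j≤k} ℚ·L_j(q₀)` via `VSpan_towerSys_le`);
`fh_decided_of_topLettersNew`: THEOREM B of §17 for every numerator up to dimension `n` from the newness of
`L_2(q₀), …, L_n(q₀)` ONLY (§17's `fh_decided` = `fh_decided_via_U` asked `LettersLinIndep q₀ n`, i.e. also
`L_1(q₀) = log(1+1/q₀) ∉ ℚ`); `fh_two_decided_of_dilog_new`: the census class `q₀ + xy` is decided, every
numerator, from `Li₂(−1/q₀) ∉ ℚ + ℚ·log(1+1/q₀)` alone.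
**INSTANCE 2 (NEW CLASS, beyond §17).** `twoSys q₁ q₂ n` = the two-point products `(q₁+u)(q₂+u)`,
`u = x₀⋯x_{k-1}`, `q₁ ≠ q₂`, and the constants: full rank, non-exact, not towers. TWO letters per level
(`1/(q₁+u)`, `1/(q₂+u)` written over the product); SPAN = partial fractions + §9 twice + the functoriality
`mul_mem_ex0m_mul : P ∈ Ex0m Q → P·R ∈ Ex0m (Q·R)` (`span_two`); INDEP = `TwoPointNew q₁ q₂ k` (the two top
letters jointly new over `ℚ + Σ_{j≤k}(ℚ·L_j(q₁) + ℚ·L_j(q₂))`, via `value_twoR` / `VSpan_twoSys_le`) — in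
print for `q₂/q₁ ∈ ℚ` fixed and large height [David–Hirata-Kohno–Kawashima, arXiv:2010.09167, Thm. 1 /
Cor. 1: `1, Li_s(α₁/β), Li_s(α₂/β)`, `s ≤ r`, are `ℚ`-linearly independent for `β ≥ β₀`]; `two_decided`,
`two_single` (26322's own binders), `two_decided_dim_two` (`(q₁+xy)(q₂+xy)` from the two dilogarithms).
WHAT IT BUYS. (i) The residual (C) of g14 is TYPED: `SpecialKernel` = 26322 restricted to the `Q` in NO
generic system — every zero-free face-closed system through `Q` carries, at some level `≥ 2`, a genuine
`ℚ`-linear relation among its letters modulo all lower values (or misses SPAN). By Grothendieck's period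
conjecture such a relation is itself of motivic origin: the special locus is exactly where KZ moves OTHER
than Stokes-on-the-cube and linearity (rule 2 with non-affine substitutions — e.g. `(x,y) ↦ (x²,y²)`
realising Landen's `Li₂(z) + Li₂(−z) = ½Li₂(z²)` on the three-point product `(q+xy)(−q+xy)(−q²+xy)`, a
CERTIFIED special resident) are needed. (ii) ONE cut re-indexes ALL of 26322 (every `Q`, every `m`), and
the generic side is PROVABLY larger than g14's (B) (Instance 2). (iii) The Diophantine input is asked only
where it is needed — at levels `≥ 2`, modulo the lower span — never at levels `0, 1`, where Baker decides.
-/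

section LetterCriterion

variable {k : ℕ}

/-! ### Values as honest integrals; scaling a numerator; rationality of polynomial integrals -/

/-- `∫_{[0,1]^k} P/F dx` for ANY `P, F ∈ ℚ[x]` (an honest integral, no side condition; for a regular
rational function it is the value of its cube representation, `value_eq_cubeVal`). (folklore) -/
def cubeVal (k : ℕ) (P F : MvPolynomial (Fin k) ℚ) : ℝ := ∫ x in KZ.cube k, aeval x P / aeval x F

/-- Auxiliary step `value_eq_cubeVal` (§18): value eq cube Val. [bookkeeping] -/
theorem value_eq_cubeVal (T : RFun k) : T.rep.value = cubeVal k T.num T.den := rfl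

/-- Scaling the numerator by a rational constant. (folklore) -/
def smulNum (r : ℚ) (T : RFun k) : RFun k := ⟨C r * T.num, T.den, T.den_ne⟩

/-- Auxiliary step `smulNum_den` (§18): smul Num den. [bookkeeping] -/
@[simp] theorem smulNum_den (r : ℚ) (T : RFun k) : (smulNum r T).den = T.den := rfl

/-- Auxiliary step `smulNum_num` (§18): smul Num num. [bookkeeping] -/
@[simp] theorem smulNum_num (r : ℚ) (T : RFun k) : (smulNum r T).num = C r * T.num := rfl

/-- Auxiliary step `fn_smulNum` (§18): fn smul Num. [bookkeeping] -/
theorem fn_smulNum (r : ℚ) (T : RFun k) (x : Fin k → ℝ) : (smulNum r T).fn x = (r : ℝ) * T.fn x := by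
  simp only [RFun.fn_apply, smulNum, map_mul, MvPolynomial.aeval_C, eq_ratCast, mul_div_assoc]

/-- `value [r·P/Q] = r · value [P/Q]`. [folklore] -/
theorem value_smulNum (r : ℚ) (T : RFun k) : (smulNum r T).rep.value = r * T.rep.value := by
  rw [value_rep_eq, value_rep_eq, ← integral_const_mul]
  have : (fun x => (smulNum r T).fn x) = fun x => (r : ℝ) * T.fn x := funext (fn_smulNum r T)
  rw [this]

/-- Soundness, summed: `[U] ≡ Σ_a [t_a] ⟹ value U = Σ_a value t_a`. (cite KontsevichZagier2001, §1.2) -/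
theorem value_eq_sum_of_rel {ι : Type*} (s : Finset ι) {n : ℕ} (t : ι → RFun n) (U : RFun k)
    (h : KZ.of U.rep - ∑ a ∈ s, KZ.of (t a).rep ∈ KZ.relations) :
    U.rep.value = ∑ a ∈ s, (t a).rep.value := by
  have := eval_eq_of_sub_mem h
  rw [eval_of, map_sum] at this
  simpa only [eval_of] using this

/-- `∫_{[0,1]^k} P dx ∈ ℚ` for `P ∈ ℚ[x]`: one Stokes move along the last variable with a polynomial
primitive, induction on `k` (no Fubini). [folklore] -/
theorem exists_rat_value_poly : ∀ (k : ℕ) (P : MvPolynomial (Fin k) ℚ),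
    ∃ r : ℚ, (RFun.poly P : RFun k).rep.value = r
  | 0, P => by
    refine ⟨P.coeff 0, ?_⟩
    have hfn : ∀ x : Fin 0 → ℝ, (RFun.poly P : RFun 0).fn x = ((P.coeff 0 : ℚ) : ℝ) := by
      intro x
      rw [RFun.fn_poly]
      conv_lhs => rw [MvPolynomial.eq_C_of_isEmpty P, MvPolynomial.aeval_C, eq_ratCast]
    rw [value_rep_eq, setIntegral_congr_fun KZ.measurableSet_cube (fun x _ => hfn x), setIntegral_const,
      KZ.volume_real_cube, one_smul]
  | k + 1, P => by
    obtain ⟨G, hG⟩ := exists_pderiv_eq (Fin.last k) P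
    obtain ⟨r₁, hr₁⟩ := exists_rat_value_poly k (bind₁ (RFun.faceSubst k 1) G)
    obtain ⟨r₀, hr₀⟩ := exists_rat_value_poly k (bind₁ (RFun.faceSubst k 0) G)
    refine ⟨r₁ - r₀, ?_⟩
    have hst := RFun.stokes (RFun.poly G : RFun (k + 1))
    have h1 : KZ.of (RFun.poly P : RFun (k + 1)).rep - KZ.of (RFun.poly G : RFun (k + 1)).dlast.rep
        ∈ KZ.relations :=
      RFun.rel_of_eqOn fun x _ => by
        rw [RFun.fn_poly, RFun.fn_apply]
        show aeval x P = aeval x (pderiv (Fin.last k) G * 1 - G * pderiv (Fin.last k) 1) / aeval x (1 ^ 2)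
        simp [hG]
    have hf : ∀ (c : ℚ) (hc : 0 ≤ c ∧ c ≤ 1),
        KZ.of ((RFun.poly G : RFun (k + 1)).face c hc).rep
          - KZ.of (RFun.poly (bind₁ (RFun.faceSubst k c) G) : RFun k).rep ∈ KZ.relations :=
      fun c hc => RFun.rel_of_eqOn fun x _ => by
        rw [RFun.fn_poly, RFun.fn_apply]
        show aeval x (bind₁ (RFun.faceSubst k c) G) / aeval x (bind₁ (RFun.faceSubst k c) 1) = _
        rw [map_one, map_one, div_one]
    have e1 := eval_eq_of_sub_mem h1
    have e2 := eval_eq_of_sub_mem hst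
    have e3 := eval_eq_of_sub_mem (hf 1 ⟨zero_le_one, le_rfl⟩)
    have e4 := eval_eq_of_sub_mem (hf 0 ⟨le_rfl, zero_le_one⟩)
    have hv1 : (RFun.poly (bind₁ (RFun.faceSubst k 1) G) : RFun k).rep.value
        = eval (KZ.of (RFun.poly (bind₁ (RFun.faceSubst k 1) G) : RFun k).rep) := (eval_of _).symm
    have hv0 : (RFun.poly (bind₁ (RFun.faceSubst k 0) G) : RFun k).rep.value
        = eval (KZ.of (RFun.poly (bind₁ (RFun.faceSubst k 0) G) : RFun k).rep) := (eval_of _).symm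
    rw [hv1, ← e3] at hr₁
    rw [hv0, ← e4] at hr₀; rw [← eval_of, e1, e2, map_sub, hr₁, hr₀, Rat.cast_sub]

/-- The value of `[P/u]` (`u ∈ ℚˣ` a constant denominator) is rational. [folklore] -/
theorem exists_rat_value_of_den_C (T : RFun k) {u : ℚ} (hT : T.den = C u) :
    ∃ r : ℚ, T.rep.value = r := by
  obtain ⟨r, hr⟩ := exists_rat_value_poly k (C u⁻¹ * T.num); refine ⟨r, ?_⟩; rw [← hr]; refine value_eq_of_fn_eq fun x _ => ?_
  rw [RFun.fn_apply, RFun.fn_poly, hT, map_mul, MvPolynomial.aeval_C, MvPolynomial.aeval_C, eq_ratCast,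
    eq_ratCast, Rat.cast_inv, div_eq_inv_mul]

/-! ### Inserting a coordinate; clean faces; the signed face family of an exact numerator -/

/-- Auxiliary step `insertNth_mem_cube` (§18): insert Nth mem cube. [bookkeeping] -/
theorem insertNth_mem_cube {x : Fin k → ℝ} (hx : x ∈ KZ.cube k) (j : Fin (k + 1)) {c : ℚ}
    (hc : 0 ≤ c ∧ c ≤ 1) : Fin.insertNth j (c : ℝ) x ∈ KZ.cube (k + 1) := by
  rw [← RFun.snoc_comp_toLast]
  have h : (Fin.snoc x (c : ℝ) : Fin (k + 1) → ℝ) ∈ KZ.cube (k + 1) :=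
    KZ.snoc_mem_cube_iff.2 ⟨hx, by exact_mod_cast hc.1, by exact_mod_cast hc.2⟩
  exact fun i => h _

/-- The CLEAN FACE `x_j := c` of `G_j/F` (variables re-indexed along `j.succAbove`): `G_j| / F|`.
(folklore) -/
def cface (F : MvPolynomial (Fin (k + 1)) ℚ) (hF : ∀ x ∈ KZ.cube (k + 1), aeval x F ≠ 0)
    (Gj : MvPolynomial (Fin (k + 1)) ℚ) (j : Fin (k + 1)) (c : ℚ) (hc : 0 ≤ c ∧ c ≤ 1) : RFun k :=
  ⟨bind₁ (insX j c) Gj, bind₁ (insX j c) F, fun x hx => by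
    rw [aeval_bind₁_insX]; exact hF _ (insertNth_mem_cube hx j hc)⟩

/-- Auxiliary step `cface_den` (§18): cface den. [bookkeeping] -/
theorem cface_den (F : MvPolynomial (Fin (k + 1)) ℚ) (hF : ∀ x ∈ KZ.cube (k + 1), aeval x F ≠ 0)
    (Gj : MvPolynomial (Fin (k + 1)) ℚ) (j : Fin (k + 1)) (c : ℚ) (hc : 0 ≤ c ∧ c ≤ 1) :
    (cface F hF Gj j c hc).den = bind₁ (insX j c) F := rfl

/-- Auxiliary step `fn_cface` (§18): fn cface. [bookkeeping] -/
theorem fn_cface (F : MvPolynomial (Fin (k + 1)) ℚ) (hF : ∀ x ∈ KZ.cube (k + 1), aeval x F ≠ 0)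
    (Gj : MvPolynomial (Fin (k + 1)) ℚ) (j : Fin (k + 1)) (c : ℚ) (hc : 0 ≤ c ∧ c ≤ 1) (x : Fin k → ℝ) :
    (cface F hF Gj j c hc).fn x
      = aeval (Fin.insertNth j (c : ℝ) x) Gj / aeval (Fin.insertNth j (c : ℝ) x) F := by
  rw [RFun.fn_apply]; show aeval x (bind₁ (insX j c) Gj) / aeval x (bind₁ (insX j c) F) = _; rw [aeval_bind₁_insX, aeval_bind₁_insX]

end LetterCriterion
end Summit.KontsevichZagierPeriods.RootDecompRationalCubeDichotomy.Rung26322.RankDescent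
end
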